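import Literature.NumberTheory.EllipticCurves.CuspFormTwistModularSymbol
import Literature.NumberTheory.EllipticCurves.PAdicLFunctionMinus
import Literature.NumberTheory.EllipticCurves.PAdicLFunctionDistributionHoldsProofs
import Literature.NumberTheory.EllipticCurves.ModularFormsGamma0Genus
import HarnessLib

/-!
# The rational plus symbol of an ODD quadratic twist: `[r]⁺_{f_χ} = c · ∑_{u mod m} χ(u) [r + u/m]⁻_f`
# (Mazur–Tate–Teitelbaum 1986, §I.8; Shimura 1971, Prop. 3.64)

Odd twin of `CuspFormTwistRatPlusSymbol`. For an ODD primitive quadratic character `χ mod m` (e.g.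
`χ = (·/p)` for a prime `p ≡ 3 (mod 4)`, the character of `ℚ(√−p)`) the plus symbol of the twist
`F = f_χ = charTwist L hN hm hχ f` is a twisted sum of MINUS symbols of `f`
(`plusSymbol_charTwist_of_odd`: `{∞, −r}` is reached through `u ↦ −u` at the cost of `χ(−1) = −1`).
For rational newforms `f`, `F` this reads, on the tree's `Ω^±`-normalised rational symbols
(`ratPlusSymbol`, and the lit seat's `ratMinusSymbol` with `[r]⁻_f · Ω⁻_f · i = minusSymbol f r`,
`ratMinusSymbol_mul_minusPeriod_mul_I`):

* `ratPlusSymbol_charTwist_mul_plusPeriod_mul_gaussSum_of_odd`: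
  `[r]⁺_F · Ω⁺_F · g(χ) = i Ω⁻_f · ∑_u χ(u) [r + u/m]⁻_f` in `ℂ`, for every `r ∈ ℚ`;
* `exists_rat_forall_ratPlusSymbol_charTwist_eq_of_odd`: ONE rational constant `c` with
  `[r]⁺_F = c · ∑_u ε(u) [r + u/m]⁻_f` for all `r` (`χ = ε` integer-valued), and
  `c · Ω⁺_F · g(χ) = i Ω⁻_f` when one twisted sum is non-zero (`g(χ) = ± i√m`, so `c` is real:
  `c = Ω⁻_f/(√m Ω⁺_F)` up to sign — the Pal 2012 period ratio for `d < 0`).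

This is the case of the cell `b2b-bsdres` at `p = 3` (`p* = −3`) and at every `p ≡ 3 (mod 4)`: the
plus-symbol data of an additive curve `W = V ⊗ χ_{p*}` (Kurihara numbers, level-lowering certificates)
are read on the MINUS symbol of the semistable twist `V`. Everything is proved; no named fact, no
definition.

## References

* B. Mazur, J. Tate, J. Teitelbaum, Invent. Math. 84 (1986), §I.8. [MazurTateTeitelbaum1986Invent]
* G. Shimura, *Introduction to the arithmetic theory of automorphic functions* (1971), Prop. 3.64. [Shimura1971]
-/

noncomputable section

open scoped MatrixGroups ModularForm Real

open CongruenceSubgroup UpperHalfPlane Complex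

namespace Literature.NumberTheory.EllipticCurves.ModularForms

section RatTwistOdd

variable {N : ℕ} [NeZero N] {m : ℕ} [NeZero m] (L : ℕ) [NeZero L]

/-- `[r]⁺_F · Ω⁺_F = plusSymbol F r` in `ℂ` for a rational newform (restated locally from
`ratCast_ratPlusSymbol_holds`, `IsNewform0.plusPeriod_pos_holds`, `plusSymbol_eq_re_of`).
[cite: MazurTateTeitelbaum1986Invent, §I.8] -/
private theorem ratCast_ratPlusSymbol_mul_plusPeriod' (F : CuspForm (Gamma0 L) 2) (hF : IsNewform0 F)
    (hQF : coeffField F = ⊥) (r : ℚ) :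
    ((ratPlusSymbol F r : ℚ) : ℂ) * (plusPeriod F : ℂ) = plusSymbol F r := by
  have hΩ : 0 < plusPeriod F := IsNewform0.plusPeriod_pos_holds hF hQF
  have hreal := plusSymbol_eq_re_of F (modularSymbol_neg_eq_conj_holds F)
    (cuspCoeff_im_eq_zero_of_coeffField_eq_bot hQF) r
  have hcast : ((ratPlusSymbol F r : ℚ) : ℝ) = (plusSymbol F r).re / plusPeriod F := by
    rw [ratCast_ratPlusSymbol_holds hF hQF r, normalizedPlusSymbol]
  have hC : ((ratPlusSymbol F r : ℚ) : ℂ) = ((((ratPlusSymbol F r : ℚ) : ℝ)) : ℂ) := by norm_cast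
  rw [hC, hcast, hreal, Complex.ofReal_re, Complex.ofReal_div, div_mul_cancel₀]
  exact_mod_cast hΩ.ne'

/-- **The rational plus symbol of the twist, ODD primitive quadratic `χ`**:
`[r]⁺_{f_χ} · Ω⁺_{f_χ} · g(χ) = i Ω⁻_f · ∑_{u mod m} χ(u) [r + u/m]⁻_f` in `ℂ`, for rational newforms
`f` and `f_χ = charTwist L hN hm hχ f` (MTT 1986 §I.8; `plusSymbol_charTwist_of_odd` and
`ratMinusSymbol_mul_minusPeriod_mul_I`).
[cite: MazurTateTeitelbaum1986Invent, §I.8] [cite: Shimura1971, Prop. 3.64] -/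
theorem ratPlusSymbol_charTwist_mul_plusPeriod_mul_gaussSum_of_odd (hN : N ∣ L) (hm : m ^ 2 ∣ L)
    {χ : DirichletCharacter ℂ m} (hχ : χ.IsQuadratic) (hχo : χ.Odd) (hχp : χ.IsPrimitive)
    {f : CuspForm (Gamma0 N) 2} (hf : IsNewform0 f) (hQ : coeffField f = ⊥)
    (hF : IsNewform0 (charTwist L hN hm hχ f)) (hQF : coeffField (charTwist L hN hm hχ f) = ⊥)
    (r : ℚ) :
    ((ratPlusSymbol (charTwist L hN hm hχ f) r : ℚ) : ℂ) * (plusPeriod (charTwist L hN hm hχ f) : ℂ) *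
        gaussSum χ (ZMod.stdAddChar (N := m)) =
      (minusPeriod f : ℂ) * Complex.I *
        ∑ u : ZMod m, χ u * ((ratMinusSymbol f (r + twistShift u) : ℚ) : ℂ) := by
  have hg : gaussSum χ (ZMod.stdAddChar (N := m)) ≠ 0 := gaussSum_stdAddChar_ne_zero_of_isPrimitive hχp
  rw [ratCast_ratPlusSymbol_mul_plusPeriod' L _ hF hQF, plusSymbol_charTwist_of_odd L hN hm hχ hχo f r]
  have hterm : ∀ u : ZMod m, (minusPeriod f : ℂ) * Complex.I *
      (χ u * ((ratMinusSymbol f (r + twistShift u) : ℚ) : ℂ)) =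
      χ u * minusSymbol f (r + twistShift u) := fun u ↦ by
    rw [← ratMinusSymbol_mul_minusPeriod_mul_I f hf hQ]
    ring
  have hR : (minusPeriod f : ℂ) * Complex.I *
      ∑ u : ZMod m, χ u * ((ratMinusSymbol f (r + twistShift u) : ℚ) : ℂ) =
      ∑ u : ZMod m, χ u * minusSymbol f (r + twistShift u) := by
    rw [Finset.mul_sum]
    exact Finset.sum_congr rfl fun u _ ↦ hterm u
  rw [hR, mul_comm, ← mul_assoc, mul_inv_cancel₀ hg, one_mul]

/-- **ONE rational constant (odd `χ`)**: for rational newforms `f`, `f_χ` and an odd primitive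
quadratic `χ = ε` (integer-valued, e.g. the Legendre symbol mod a prime `m ≡ 3 (mod 4)`), there is
`c ∈ ℚ` with `[r]⁺_{f_χ} = c · ∑_{u mod m} ε(u) [r + u/m]⁻_f` for EVERY `r ∈ ℚ`, and
`c · Ω⁺_{f_χ} · g(χ) = i Ω⁻_f` as soon as one twisted sum is non-zero.
[cite: MazurTateTeitelbaum1986Invent, §I.8] [cite: Shimura1971, Prop. 3.64] -/
theorem exists_rat_forall_ratPlusSymbol_charTwist_eq_of_odd (hN : N ∣ L) (hm : m ^ 2 ∣ L)
    {χ : DirichletCharacter ℂ m} (hχ : χ.IsQuadratic) (hχo : χ.Odd) (hχp : χ.IsPrimitive)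
    {f : CuspForm (Gamma0 N) 2} (hf : IsNewform0 f) (hQ : coeffField f = ⊥)
    (hF : IsNewform0 (charTwist L hN hm hχ f)) (hQF : coeffField (charTwist L hN hm hχ f) = ⊥)
    (ε : ZMod m → ℤ) (hε : ∀ u, χ u = (ε u : ℂ)) :
    ∃ c : ℚ, (∀ r : ℚ, ratPlusSymbol (charTwist L hN hm hχ f) r =
        c * ∑ u : ZMod m, (ε u : ℚ) * ratMinusSymbol f (r + twistShift u)) ∧
      ((∃ r : ℚ, ∑ u : ZMod m, (ε u : ℚ) * ratMinusSymbol f (r + twistShift u) ≠ 0) →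
        (c : ℂ) * (plusPeriod (charTwist L hN hm hχ f) : ℂ) * gaussSum χ (ZMod.stdAddChar (N := m)) =
          (minusPeriod f : ℂ) * Complex.I) := by
  set F := charTwist L hN hm hχ f with hFdef
  set S : ℚ → ℚ := fun r ↦ ∑ u : ZMod m, (ε u : ℚ) * ratMinusSymbol f (r + twistShift u) with hSdef
  have hg : gaussSum χ (ZMod.stdAddChar (N := m)) ≠ 0 := gaussSum_stdAddChar_ne_zero_of_isPrimitive hχp
  have hΩF : (plusPeriod F : ℂ) ≠ 0 := by exact_mod_cast (IsNewform0.plusPeriod_pos_holds hF hQF).ne'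
  have key : ∀ r : ℚ, ((ratPlusSymbol F r : ℚ) : ℂ) * (plusPeriod F : ℂ) *
      gaussSum χ (ZMod.stdAddChar (N := m)) = (minusPeriod f : ℂ) * Complex.I * ((S r : ℚ) : ℂ) := by
    intro r
    rw [ratPlusSymbol_charTwist_mul_plusPeriod_mul_gaussSum_of_odd L hN hm hχ hχo hχp hf hQ hF hQF r,
      hSdef]
    push_cast
    congr 1
    exact Finset.sum_congr rfl fun u _ ↦ by rw [hε u]
  by_cases hex : ∃ r₀ : ℚ, S r₀ ≠ 0
  · obtain ⟨r₀, hr₀⟩ := hex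
    refine ⟨ratPlusSymbol F r₀ / S r₀, fun r ↦ ?_, fun _ ↦ ?_⟩
    · have h1 := key r
      have h0 := key r₀
      have hS0 : ((S r₀ : ℚ) : ℂ) ≠ 0 := by exact_mod_cast hr₀
      have hK : (plusPeriod F : ℂ) * gaussSum χ (ZMod.stdAddChar (N := m)) ≠ 0 := mul_ne_zero hΩF hg
      have hC : ((ratPlusSymbol F r : ℚ) : ℂ) =
          ((ratPlusSymbol F r₀ : ℚ) : ℂ) / ((S r₀ : ℚ) : ℂ) * ((S r : ℚ) : ℂ) := by
        apply mul_right_cancel₀ hK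
        rw [div_mul_eq_mul_div, div_mul_eq_mul_div, eq_div_iff hS0]
        linear_combination (((S r₀ : ℚ) : ℂ)) * h1 - (((S r : ℚ) : ℂ)) * h0
      change ratPlusSymbol F r = ratPlusSymbol F r₀ / S r₀ * S r
      exact_mod_cast hC
    · have h0 := key r₀
      have hS0 : ((S r₀ : ℚ) : ℂ) ≠ 0 := by exact_mod_cast hr₀
      push_cast
      rw [div_mul_eq_mul_div, div_mul_eq_mul_div, div_eq_iff hS0]
      linear_combination h0
  · simp only [not_exists, not_not] at hex
    refine ⟨0, fun r ↦ ?_, fun ⟨r₀, hr₀⟩ ↦ absurd (hex r₀) hr₀⟩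
    have h1 := key r
    rw [hex r, Rat.cast_zero, mul_zero] at h1
    have : ((ratPlusSymbol F r : ℚ) : ℂ) = 0 := by
      rcases mul_eq_zero.mp h1 with h | h
      · rcases mul_eq_zero.mp h with h' | h'
        · exact h'
        · exact absurd h' hΩF
      · exact absurd h hg
    have hz : ratPlusSymbol F r = 0 := by exact_mod_cast this
    rw [hz, zero_mul]

end RatTwistOdd

end Literature.NumberTheory.EllipticCurves.ModularForms

end
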